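import Mathlib.RingTheory.KrullDimension.Basic
import Mathlib.RingTheory.Ideal.KrullsHeightTheorem
import Mathlib.RingTheory.LocalRing.RingHom.Basic
import Mathlib.RingTheory.Ideal.Quotient.Operations
import Literature.RingTheory.TightClosure.TightClosure
import HarnessLib

/-!
# Extending a partial system of parameters (crux `FrobeniusLadder.FInjectiveMacaulayfication`, line `Sketch`)

Stub `stub_extendSop` of the skeleton `Sketch` for crux stmt-ResolutionOfSingularities-15315 (route
`FrobeniusLadder`; cycle-4 degree-zero descent toolbox). The standard dimension-theoretic fact: in a
Noetherian local ring `(R, 𝔪)` of dimension `d + e`, any `d` elements `s = (s₀, …, s_{d-1})` with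
`dim R/(s) = e` extend to a system of parameters `(s, t)` of `R` (in the tree's sense
`Literature.RingTheory.TightClosure.IsSystemOfParameters`: `dim R = d + e` and `rad (s, t) = 𝔪`).

Proof [folklore]. Put `I = (s)`. Since `dim R/I = e ≠ ⊥`, `I ≠ ⊤`, so `R/I` is a Noetherian local
ring of dimension `e` and has a system of parameters `t̄ : Fin e → R/I`
(`Literature.RingTheory.TightClosure.exists_isSystemOfParameters`, Krull's height theorem). Lift `t̄`
to `t : Fin e → R`. Then `J = (s, t)` satisfies `I ≤ J`, `(t) ≤ J`, and the image of `(t)` in `R/I`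
is `(t̄)`, whose radical is `𝔪/I`. Hence `J ≤ 𝔪` (the `s_i` lie in the proper ideal `I`, the `t_j`
pull back from `𝔪/I`), so `rad J ≤ 𝔪`; and for `x ∈ 𝔪` some power `x̄ⁿ ∈ (t̄)`, i.e.
`xⁿ ∈ (t) + I ≤ J`, so `𝔪 ≤ rad J`.
-/

-- single-problem summit: the doubled namespace component is forced
set_option linter.dupNamespace false

open Literature.RingTheory.TightClosure IsLocalRing

namespace Summit.ResolutionOfSingularities.ResolutionOfSingularities.Theorems.FInjectiveMacaulayfication.ExtendSop

/-- **Extending a partial system of parameters.** In a Noetherian local ring `R` of dimension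
`d + e`, if `s : Fin d → R` satisfies `dim R/(s) = e`, then there is `t : Fin e → R` such that the
concatenation `(s, t) : Fin (d + e) → R` is a system of parameters of `R`: lift a system of parameters
of the `e`-dimensional Noetherian local ring `R/(s)` and compare radicals through `R → R/(s)`.
[folklore] -/
theorem stub_extendSop : ∀ (R : Type) [CommRing R] [IsNoetherianRing R] [IsLocalRing R] (d e : ℕ)
    (s : Fin d → R), ringKrullDim R = ((d + e : ℕ) : WithBot ℕ∞) →
    ringKrullDim (R ⧸ Ideal.span (Set.range s)) = (e : WithBot ℕ∞) →
    ∃ t : Fin e → R, Literature.RingTheory.TightClosure.IsSystemOfParameters (Fin.append s t) := by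
  intro R _ _ _ d e s hdim hquot
  set I : Ideal R := Ideal.span (Set.range s) with hI
  -- `I` is proper: otherwise `R/I` is the zero ring, of dimension `⊥ ≠ e`
  have hItop : I ≠ ⊤ := by
    intro h
    haveI : Subsingleton (R ⧸ I) := Ideal.Quotient.subsingleton_iff.mpr h
    rw [ringKrullDim_eq_bot_of_subsingleton] at hquot
    exact WithBot.bot_ne_natCast e hquot
  -- so `R/I` is a Noetherian local ring and `R → R/I` is a local homomorphism
  haveI : Nontrivial (R ⧸ I) := Ideal.Quotient.nontrivial_iff.mpr hItop
  haveI : IsLocalRing (R ⧸ I) :=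
    IsLocalRing.of_surjective' (Ideal.Quotient.mk I) Ideal.Quotient.mk_surjective
  haveI : IsLocalHom (Ideal.Quotient.mk I) :=
    IsLocalHom.of_surjective (Ideal.Quotient.mk I) Ideal.Quotient.mk_surjective
  have hmax : Ideal.comap (Ideal.Quotient.mk I) (maximalIdeal (R ⧸ I)) = maximalIdeal R :=
    maximalIdeal_comap _
  -- a system of parameters `t̄` of `R/I`, lifted to `t : Fin e → R`
  obtain ⟨tbar, -, htbar⟩ := exists_isSystemOfParameters (R := R ⧸ I) hquot
  choose t ht using fun j => Ideal.Quotient.mk_surjective (tbar j)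
  refine ⟨t, hdim, ?_⟩
  -- `J = (s, t)` contains `I = (s)` and `(t)`; the image of `(t)` in `R/I` is `(t̄)`
  set J : Ideal R := Ideal.span (Set.range (Fin.append s t)) with hJ
  have hIJ : I ≤ J := by
    refine Ideal.span_mono ?_
    rintro _ ⟨i, rfl⟩
    exact ⟨Fin.castAdd e i, Fin.append_left s t i⟩
  have htJ : Ideal.span (Set.range t) ≤ J := by
    refine Ideal.span_mono ?_
    rintro _ ⟨j, rfl⟩
    exact ⟨Fin.natAdd d j, Fin.append_right s t j⟩
  have hcomp : (Ideal.Quotient.mk I) ∘ t = tbar := funext ht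
  have hmap : (Ideal.span (Set.range t)).map (Ideal.Quotient.mk I) = Ideal.span (Set.range tbar) := by
    rw [Ideal.map_span, ← Set.range_comp, hcomp]
  -- all the parameters lie in `𝔪`
  have hsm : ∀ i, s i ∈ maximalIdeal R := fun i =>
    le_maximalIdeal hItop (Ideal.subset_span ⟨i, rfl⟩)
  have htm : ∀ j, t j ∈ maximalIdeal R := fun j => by
    rw [← hmax, Ideal.mem_comap, ht, ← htbar]
    exact Ideal.le_radical (Ideal.subset_span ⟨j, rfl⟩)
  refine le_antisymm ?_ ?_
  · -- `rad J ≤ 𝔪` since `J ≤ 𝔪`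
    refine (maximalIdeal.isMaximal R).isPrime.radical_le_iff.mpr (Ideal.span_le.mpr ?_)
    rintro _ ⟨k, rfl⟩
    refine Fin.addCases (fun i => ?_) (fun j => ?_) k
    · rw [Fin.append_left]
      exact hsm i
    · rw [Fin.append_right]
      exact htm j
  · -- `𝔪 ≤ rad J`: `x ∈ 𝔪 ⇒ x̄ ∈ 𝔪/I = rad (t̄) ⇒ x̄ⁿ ∈ (t̄) ⇒ xⁿ ∈ (t) + I ≤ J`
    intro x hx
    rw [← hmax, Ideal.mem_comap, ← htbar] at hx
    obtain ⟨n, hn⟩ := hx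
    rw [← map_pow, ← hmap, Ideal.mem_quotient_iff_mem_sup] at hn
    exact ⟨n, sup_le htJ hIJ hn⟩

end Summit.ResolutionOfSingularities.ResolutionOfSingularities.Theorems.FInjectiveMacaulayfication.ExtendSop
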